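import Summits.QuantumFields.BalabanUV.Beta.SpineRootedBmN
import Summits.QuantumFields.BalabanUV.Beta.S0NReflection
import Summits.QuantumFields.BalabanUV.Beta.StepReflection
import Summits.QuantumFields.BalabanUV.Beta.DiagonalContactLoc
import Summits.QuantumFields.BalabanUV.Beta.BorderedHessianStep

/-!
# `hR` FOR THE NATIVE BLOCK-MEAN-DRESSED SPINE WITH an2's SOCKETS DISCHARGED: reflection covariance of every `flipK (TbalOf Lc (JsBalBmNAtOf …) j)`
# from EXACTLY — a bordered-shape binder `𝕄_j` with rules 3–4 for `j ≥ 1`, the Wilson ff-law at `j = 0`, the value-function ff-laws at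
# `j ≥ 1`, and the suppliers' second-order law hWrC / table contacts `X₂` (β sub-cell, row BETA-an2, gen 14; X-an2-45 §3 / (R45-1), (R45-4))

HONEST FRAMING (cell charter, verbatim): «discharging BetaPertH makes Balaban's UV stability UNCONDITIONAL — a real
constructive-QFT result; it is NOT the continuum limit and NOT the Clay problem.»  DERIVED cell leaf (pub-balaban β sub-cell, lane
an2 gen 14); no statement of Bałaban's papers is typed here, no `[cite:]` tag, no `Prop` fact; it instantiates no binder of the
β-function wall by itself — it RE-ISSUES the wiring `SpineRooted.axisReflectionCovariant_flipK_TbalOf_JsBalBmNAtOf_ctrC` with the sockets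
this lane has discharged filled in BY NAME, leaving as hypotheses only what other suppliers own.  NOT `BetaPertH`; NOT continuum; NOT Clay.

## What is here ([folklore] wiring only)

**`axisReflectionCovariant_flipK_TbalOf_JsBalBmNAtOf_ctrC_reduced`**: `∀ j, AxisReflectionCovariant (flipK (TbalOf Lc (JsBalBmNAtOf …) j))`
(`d + 1 = 4`, odd `Lc`, centred root) from:
* the second-order data `W` of the spine (`VertexFamily₂`, block-translation covariant) — as in the wiring;
* a kernel family `M` with `M 0 = bhKAt 3 ρ_c Lc` (so h3/h4/hM at `j = 0` are DISCHARGED inside by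
  `BorderedHessian.relInv_coDressKBmAt_KInvStep_zero_bhKAt` / `spr_bhKAt`), and for `j ≥ 1`: spread, rules 3–4 against `axEc ρ_c Lc`
  (h3S/h4S — the OPEN binder, an4-g33's `[[T_j, −M^{d+2}𝒬ᵀ],[M^{d+2}𝒬, 0]]` is the candidate) and BORDERED SHAPE with scale `s j ≠ 0`
  (`hfm`/`hmf`/`hmm`: border `= s j ·` that of `bhKAt 3 ρ_c Lc`, multiplier block `0`);
* the contact family FIXED by the vh-slice: `C j α κ′ u = γ j • diagK (ctGen 3 α Lc κ′ u)` with `γ 0 = cVH / Lc^4`,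
  `γ (j+1) = cVH·wVH 3 Lc (j+1) / (s (j+1)·Lc^4)` — its sockets hC (`locStencil_smul_diagK_ctGen`) and hEC (`comp_axEc_diagK_comm`) are
  DISCHARGED inside;
* the Wilson ff-law at `j = 0` (`hWff`, constant `c 0`, `cE·c 0 = γ 0`; an3's «WILSON-REFLECTION-WITH-CONTACT» S2/S3) and the value-function
  ff-laws at `j ≥ 1` (`hE3ff`, constants `c (j+1)`, `cE·wE 3 Lc (j+1)·c (j+1) = γ (j+1)`) — hSrC is then DISCHARGED inside by
  `S0NAt_bref_of_wilsonLaw` / `SstepNAt_bref_of_e3Law`;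
* the suppliers' sockets verbatim: table contacts `X₂` (`Loc`, commuting with `axEc`) and the conjugated second-order law hWrC.
**`axisReflectionCovariant_flipK_TbalOf_JsBalBmNAtOf_ctrC_candidate`**: the same with the CANDIDATE binder `M := bhKStepAt 3 ρ_c Lc`
(`BorderedHessianStep`: `bhKAt` at `0`, `[[wVH·E2, M^{d+2}·border],[M^{d+2}·border, 0]]` at `j+1`) — `hM0`, spread and bordered shape are then
DISCHARGED too (`rfl`, `spr_bhKStepAt`, `bhKStepAt_succ_fm/_mf/_mm`, `s := stepScale 3 Lc`), so the remaining hypotheses are EXACTLY: rules 3–4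
for `bhKStepAt` at `j ≥ 1` (THE open binder of row D1 item (l)), the Wilson ff-law (`j = 0`), the value-function ff-laws (`j ≥ 1`), and the
W-supplier's `X₂`/hEX₂/hWrC.  All declarations `[folklore]`; axioms standard.  Provenance: b2b-balaban β sub-cell, unit beta-an2 gen 14, 2026-08-20 (v1); no existing file touched.
-/

open Finset
open scoped BigOperators
open Literature.MathematicalPhysics.QuantumFieldTheory
open Literature.MathematicalPhysics.QuantumFieldTheory.Balaban1983to89
open Literature.MathematicalPhysics.QuantumFieldTheory.Balaban1983to89.Beta
open B12Sec2to5 (l1 l1_nonneg)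
open ExpKernelCalculus (MKer Decays BiLoc comp tr VertexFamily VertexFamily₂ shiftK)
open AffineAveraging (Form1 Form2 box toSite)
open AveragingContoursRooted (ctr ctrOff ctrOff_mem_box)
open StepJetData (wilsonA)
open PolarizationSign (reflSign AxisReflectionCovariant)
open KernelReflection (refK)
open ResolventReflection (bref Φ)
open OneStepResolventKernel (Fib LocStencil JetData)
open OneStepKernelFamily (KInvStep vertexOfK TbalOf flipK)
open BalabanStepJetsSucc (wE wVH)
open Summit.QuantumFields.BalabanUV.Beta.TameKernelCalculus
open Summit.QuantumFields.BalabanUV.Beta.ChartConjugation (conjV conjW)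
open Summit.QuantumFields.BalabanUV.Beta.ChartConjugationRelative (RelInv)
open Summit.QuantumFields.BalabanUV.Beta.AxialDressingRooted (coDressKBmAt axEc one_le_of_neZero)
open Summit.QuantumFields.BalabanUV.Beta.BorderedHessian (bhKAt diagK ctGen cCT comp_axEc_diagK_comm locStencil_smul_diagK_ctGen spr_bhKAt
  relInv_coDressKBmAt_KInvStep_zero_bhKAt bhKStepAt stepScale stepScale_ne_zero bhKStepAt_succ_fm bhKStepAt_succ_mf bhKStepAt_succ_mm
  spr_bhKStepAt)

namespace Summit.QuantumFields.BalabanUV.Beta.SpineRooted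

noncomputable section

/-- [folklore] **`hR` FOR THE NATIVE BLOCK-MEAN-DRESSED SPINE, an2's SOCKETS DISCHARGED.**  See the module docstring for the list of
hypotheses; inside, h3/h4/hM at `j = 0`, hC, hEC and hSrC (every `j`) of `axisReflectionCovariant_flipK_TbalOf_JsBalBmNAtOf_ctrC` are
supplied by this lane's theorems.  Discharges nothing of the wall by itself. -/
theorem axisReflectionCovariant_flipK_TbalOf_JsBalBmNAtOf_ctrC_reduced {Lc : ℕ} [NeZero Lc] (hLc : Odd Lc) (cE cVH cΛ : ℝ)
    (W : ℕ → Fin 4 → (Fin 4 → ℤ) → Fin 4 → (Fin 4 → ℤ) → MKer 4 (Fib 3)) (Cw δw : ℕ → ℝ) (hδw : ∀ j, 0 < δw j)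
    (hW : ∀ j, VertexFamily₂ (W j) Lc (Cw j) (δw j))
    (hWt : ∀ (j : ℕ) (μ : Fin 4) (y : Fin 4 → ℤ) (ν : Fin 4) (y' t : Fin 4 → ℤ),
      W j μ (y + t) ν (y' + t) = shiftK (-((Lc : ℤ) • t)) (W j μ y ν y'))
    (M : ℕ → MKer 4 (Fib 3)) (hM0 : M 0 = bhKAt 3 (toSite (ctrOff 4 Lc)) Lc) (hMS : ∀ j, Spr (M (j + 1)))
    (h3S : ∀ j, comp (comp (coDressKBmAt (toSite (ctrOff 4 Lc)) Lc (KInvStep (d := 3) Lc (j + 1))) (M (j + 1)))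
      (axEc (toSite (ctrOff 4 Lc)) Lc) = axEc (toSite (ctrOff 4 Lc)) Lc)
    (h4S : ∀ j, comp (comp (axEc (toSite (ctrOff 4 Lc)) Lc) (M (j + 1)))
      (coDressKBmAt (toSite (ctrOff 4 Lc)) Lc (KInvStep (d := 3) Lc (j + 1))) = axEc (toSite (ctrOff 4 Lc)) Lc)
    (s : ℕ → ℝ) (hs : ∀ j, s (j + 1) ≠ 0)
    (hfm : ∀ j x z β μ, M (j + 1) x z (Sum.inl β) (Sum.inr μ) = s (j + 1) * bhKAt 3 (toSite (ctrOff 4 Lc)) Lc x z (Sum.inl β) (Sum.inr μ))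
    (hmf : ∀ j x z μ β, M (j + 1) x z (Sum.inr μ) (Sum.inl β) = s (j + 1) * bhKAt 3 (toSite (ctrOff 4 Lc)) Lc x z (Sum.inr μ) (Sum.inl β))
    (hmm : ∀ j x z μ μ', M (j + 1) x z (Sum.inr μ) (Sum.inr μ') = 0)
    (γ : ℕ → ℝ) (hγ0 : γ 0 = cVH / (Lc : ℝ) ^ 4) (hγS : ∀ j, γ (j + 1) = cVH * wVH 3 Lc (j + 1) / (s (j + 1) * (Lc : ℝ) ^ 4))
    (C : ℕ → Fin 4 → Fin 4 → (Fin 4 → ℤ) → MKer 4 (Fib 3)) (hCdef : ∀ j α κ' u, C j α κ' u = γ j • diagK (ctGen 3 α Lc κ' u))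
    (c : ℕ → ℝ) (hc0 : cE * c 0 = γ 0) (hcS : ∀ j, cE * wE 3 Lc (j + 1) * c (j + 1) = γ (j + 1))
    (hWff : ∀ (α κ' : Fin 4) (u x z : Fin 4 → ℤ) (a b : Fin 4),
      wilsonA 3 κ' (bref α κ' u) x z (Sum.inl a) (Sum.inl b) =
        reflSign α κ' * ((Φ Lc α).s (Sum.inl a) * (Φ Lc α).s (Sum.inl b) *
          (wilsonA 3 κ' u ((Φ Lc α).r (Sum.inl a) x) ((Φ Lc α).r (Sum.inl b) z) (Sum.inl a) (Sum.inl b) +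
            c 0 * conjV (bhKAt 3 (toSite (ctrOff 4 Lc)) Lc) (diagK (ctGen 3 α Lc κ' u))
              ((Φ Lc α).r (Sum.inl a) x) ((Φ Lc α).r (Sum.inl b) z) (Sum.inl a) (Sum.inl b))))
    (hE3ff : ∀ (j : ℕ) (α κ' : Fin 4) (u x z : Fin 4 → ℤ) (a b : Fin 4),
      e3NAtOf 3 Lc (toSite (ctrOff 4 Lc)) cE cVH cΛ (j + 1) κ' (bref α κ' u) x z (Sum.inl a) (Sum.inl b) =
        reflSign α κ' * ((Φ Lc α).s (Sum.inl a) * (Φ Lc α).s (Sum.inl b) *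
          (e3NAtOf 3 Lc (toSite (ctrOff 4 Lc)) cE cVH cΛ (j + 1) κ' u ((Φ Lc α).r (Sum.inl a) x) ((Φ Lc α).r (Sum.inl b) z)
              (Sum.inl a) (Sum.inl b) +
            c (j + 1) * conjV (M (j + 1)) (diagK (ctGen 3 α Lc κ' u)) ((Φ Lc α).r (Sum.inl a) x) ((Φ Lc α).r (Sum.inl b) z)
              (Sum.inl a) (Sum.inl b))))
    (X₂ : ℕ → Fin 4 → Fin 4 → (Fin 4 → ℤ) → Fin 4 → (Fin 4 → ℤ) → MKer 4 (Fib 3)) (hX₂ : ∀ j α μ y ν y', Loc (X₂ j α μ y ν y'))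
    (hEX₂ : ∀ j α μ y ν y', comp (axEc (toSite (ctrOff 4 Lc)) Lc) (X₂ j α μ y ν y') = comp (X₂ j α μ y ν y') (axEc (toSite (ctrOff 4 Lc)) Lc))
    (hWrC : ∀ (j : ℕ) (α μ : Fin 4) (y : Fin 4 → ℤ) (ν : Fin 4) (y' : Fin 4 → ℤ),
      (JsBal0NAtOf (d := 3) hLc.pos (ctrOff_mem_box hLc.pos) cE cVH cΛ W Cw δw hδw hW j).W μ (bref α μ y) ν (bref α ν y') =
        (reflSign α μ * reflSign α ν) • refK (Φ Lc α)
          ((JsBal0NAtOf (d := 3) hLc.pos (ctrOff_mem_box hLc.pos) cE cVH cΛ W Cw δw hδw hW j).W μ y ν y' +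
            conjW (M j)
              (vertexOfK (coDressKBmAt (toSite (ctrOff 4 Lc)) Lc (KInvStep (d := 3) Lc j)) Lc
                (JsBal0NAtOf (d := 3) hLc.pos (ctrOff_mem_box hLc.pos) cE cVH cΛ W Cw δw hδw hW j).S μ y)
              (vertexOfK (coDressKBmAt (toSite (ctrOff 4 Lc)) Lc (KInvStep (d := 3) Lc j)) Lc
                (JsBal0NAtOf (d := 3) hLc.pos (ctrOff_mem_box hLc.pos) cE cVH cΛ W Cw δw hδw hW j).S ν y')
              (vertexOfK (coDressKBmAt (toSite (ctrOff 4 Lc)) Lc (KInvStep (d := 3) Lc j)) Lc (C j α) μ y)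
              (vertexOfK (coDressKBmAt (toSite (ctrOff 4 Lc)) Lc (KInvStep (d := 3) Lc j)) Lc (C j α) ν y') (X₂ j α μ y ν y'))) :
    ∀ j : ℕ, AxisReflectionCovariant
      (flipK (TbalOf Lc (JsBalBmNAtOf (d := 3) hLc.pos (ctrOff_mem_box hLc.pos) cE cVH cΛ W Cw δw hδw hW) j)) := by
  have hL1 : 1 ≤ Lc := one_le_of_neZero Lc
  have hR0 := relInv_coDressKBmAt_KInvStep_zero_bhKAt (d := 3) (Lc := Lc) (ctrOff_mem_box hL1)
  -- the binder sockets: `j = 0` discharged, `j ≥ 1` from the hypotheses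
  have hM : ∀ j, Spr (M j) := by
    intro j
    cases j with
    | zero => rw [hM0]; exact spr_bhKAt hL1 (ctrOff_mem_box hL1)
    | succ j => exact hMS j
  have h3 : ∀ j, comp (comp (coDressKBmAt (toSite (ctrOff 4 Lc)) Lc (KInvStep (d := 3) Lc j)) (M j)) (axEc (toSite (ctrOff 4 Lc)) Lc) =
      axEc (toSite (ctrOff 4 Lc)) Lc := by
    intro j
    cases j with
    | zero => rw [hM0]; exact hR0.2.2.1
    | succ j => exact h3S j
  have h4 : ∀ j, comp (comp (axEc (toSite (ctrOff 4 Lc)) Lc) (M j)) (coDressKBmAt (toSite (ctrOff 4 Lc)) Lc (KInvStep (d := 3) Lc j)) =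
      axEc (toSite (ctrOff 4 Lc)) Lc := by
    intro j
    cases j with
    | zero => rw [hM0]; exact hR0.2.2.2
    | succ j => exact h4S j
  -- the contact family: localisation and commutation with `axEc`
  have hCfun : ∀ j α, C j α = fun κ' u => γ j • diagK (ctGen 3 α Lc κ' u) := fun j α => funext fun κ' => funext fun u => hCdef j α κ' u
  have hC : ∀ j α, LocStencil (C j α) (|γ j| * cCT 3 Lc 1) 1 := by
    intro j α
    rw [hCfun j α]
    exact locStencil_smul_diagK_ctGen α Lc (γ j) zero_le_one
  have hEC : ∀ j α κ' u, comp (axEc (toSite (ctrOff 4 Lc)) Lc) (C j α κ' u) = comp (C j α κ' u) (axEc (toSite (ctrOff 4 Lc)) Lc) := by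
    intro j α κ' u
    rw [hCdef, KernelReflection.comp_smul_right, KernelReflection.comp_smul_left, comp_axEc_diagK_comm]
  -- the conjugated first-order law, level by level
  have hSrC : ∀ (j : ℕ) (α κ' : Fin 4) (u : Fin 4 → ℤ),
      (JsBal0NAtOf (d := 3) hLc.pos (ctrOff_mem_box hLc.pos) cE cVH cΛ W Cw δw hδw hW j).S κ' (bref α κ' u) =
        reflSign α κ' • refK (Φ Lc α)
          ((JsBal0NAtOf (d := 3) hLc.pos (ctrOff_mem_box hLc.pos) cE cVH cΛ W Cw δw hδw hW j).S κ' u + conjV (M j) (C j α κ' u)) := by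
    intro j α κ' u
    cases j with
    | zero =>
      rw [JsBal0NAtOf_S_zero, hCdef, hγ0, hM0]
      exact S0NAt_bref_of_wilsonLaw (d := 3) hLc cE cVH cΛ (c 0) (by rw [hc0, hγ0]) hWff α κ' u
    | succ j =>
      rw [JsBal0NAtOf_S_succ, hCdef, hγS]
      exact SstepNAt_bref_of_e3Law (d := 3) hLc cE cVH cΛ (j + 1) (hs j) (hfm j) (hmf j) (hmm j) (c (j + 1))
        (by rw [hcS, hγS]) (hE3ff j) α κ' u
  exact axisReflectionCovariant_flipK_TbalOf_JsBalBmNAtOf_ctrC hLc cE cVH cΛ W Cw δw hδw hW hWt M hM h3 h4 C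
    (fun j => |γ j| * cCT 3 Lc 1) (fun _ => 1) hC (fun _ => one_pos) X₂ hX₂ hEC hEX₂ hSrC hWrC


/-- [folklore] **`hR` FOR THE NATIVE BLOCK-MEAN-DRESSED SPINE WITH THE CANDIDATE BINDER `bhKStepAt`**: as `…_reduced`, with
`M := bhKStepAt 3 ρ_c Lc` and `s := stepScale 3 Lc` — so `hM0`, spread and bordered shape are discharged as well; what remains is rules 3–4
for the candidate at `j ≥ 1`, the three families of jet laws, and the W-supplier's sockets.  Discharges nothing of the wall by itself. -/
theorem axisReflectionCovariant_flipK_TbalOf_JsBalBmNAtOf_ctrC_candidate {Lc : ℕ} [NeZero Lc] (hLc : Odd Lc) (cE cVH cΛ : ℝ)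
    (W : ℕ → Fin 4 → (Fin 4 → ℤ) → Fin 4 → (Fin 4 → ℤ) → MKer 4 (Fib 3)) (Cw δw : ℕ → ℝ) (hδw : ∀ j, 0 < δw j)
    (hW : ∀ j, VertexFamily₂ (W j) Lc (Cw j) (δw j))
    (hWt : ∀ (j : ℕ) (μ : Fin 4) (y : Fin 4 → ℤ) (ν : Fin 4) (y' t : Fin 4 → ℤ),
      W j μ (y + t) ν (y' + t) = shiftK (-((Lc : ℤ) • t)) (W j μ y ν y'))
    (h3S : ∀ j, comp (comp (coDressKBmAt (toSite (ctrOff 4 Lc)) Lc (KInvStep (d := 3) Lc (j + 1)))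
      (bhKStepAt 3 (toSite (ctrOff 4 Lc)) Lc (j + 1))) (axEc (toSite (ctrOff 4 Lc)) Lc) = axEc (toSite (ctrOff 4 Lc)) Lc)
    (h4S : ∀ j, comp (comp (axEc (toSite (ctrOff 4 Lc)) Lc) (bhKStepAt 3 (toSite (ctrOff 4 Lc)) Lc (j + 1)))
      (coDressKBmAt (toSite (ctrOff 4 Lc)) Lc (KInvStep (d := 3) Lc (j + 1))) = axEc (toSite (ctrOff 4 Lc)) Lc)
    (γ : ℕ → ℝ) (hγ0 : γ 0 = cVH / (Lc : ℝ) ^ 4)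
    (hγS : ∀ j, γ (j + 1) = cVH * wVH 3 Lc (j + 1) / (stepScale 3 Lc (j + 1) * (Lc : ℝ) ^ 4))
    (C : ℕ → Fin 4 → Fin 4 → (Fin 4 → ℤ) → MKer 4 (Fib 3)) (hCdef : ∀ j α κ' u, C j α κ' u = γ j • diagK (ctGen 3 α Lc κ' u))
    (c : ℕ → ℝ) (hc0 : cE * c 0 = γ 0) (hcS : ∀ j, cE * wE 3 Lc (j + 1) * c (j + 1) = γ (j + 1))
    (hWff : ∀ (α κ' : Fin 4) (u x z : Fin 4 → ℤ) (a b : Fin 4),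
      wilsonA 3 κ' (bref α κ' u) x z (Sum.inl a) (Sum.inl b) =
        reflSign α κ' * ((Φ Lc α).s (Sum.inl a) * (Φ Lc α).s (Sum.inl b) *
          (wilsonA 3 κ' u ((Φ Lc α).r (Sum.inl a) x) ((Φ Lc α).r (Sum.inl b) z) (Sum.inl a) (Sum.inl b) +
            c 0 * conjV (bhKAt 3 (toSite (ctrOff 4 Lc)) Lc) (diagK (ctGen 3 α Lc κ' u))
              ((Φ Lc α).r (Sum.inl a) x) ((Φ Lc α).r (Sum.inl b) z) (Sum.inl a) (Sum.inl b))))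
    (hE3ff : ∀ (j : ℕ) (α κ' : Fin 4) (u x z : Fin 4 → ℤ) (a b : Fin 4),
      e3NAtOf 3 Lc (toSite (ctrOff 4 Lc)) cE cVH cΛ (j + 1) κ' (bref α κ' u) x z (Sum.inl a) (Sum.inl b) =
        reflSign α κ' * ((Φ Lc α).s (Sum.inl a) * (Φ Lc α).s (Sum.inl b) *
          (e3NAtOf 3 Lc (toSite (ctrOff 4 Lc)) cE cVH cΛ (j + 1) κ' u ((Φ Lc α).r (Sum.inl a) x) ((Φ Lc α).r (Sum.inl b) z)
              (Sum.inl a) (Sum.inl b) +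
            c (j + 1) * conjV (bhKStepAt 3 (toSite (ctrOff 4 Lc)) Lc (j + 1)) (diagK (ctGen 3 α Lc κ' u))
              ((Φ Lc α).r (Sum.inl a) x) ((Φ Lc α).r (Sum.inl b) z) (Sum.inl a) (Sum.inl b))))
    (X₂ : ℕ → Fin 4 → Fin 4 → (Fin 4 → ℤ) → Fin 4 → (Fin 4 → ℤ) → MKer 4 (Fib 3)) (hX₂ : ∀ j α μ y ν y', Loc (X₂ j α μ y ν y'))
    (hEX₂ : ∀ j α μ y ν y', comp (axEc (toSite (ctrOff 4 Lc)) Lc) (X₂ j α μ y ν y') = comp (X₂ j α μ y ν y') (axEc (toSite (ctrOff 4 Lc)) Lc))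
    (hWrC : ∀ (j : ℕ) (α μ : Fin 4) (y : Fin 4 → ℤ) (ν : Fin 4) (y' : Fin 4 → ℤ),
      (JsBal0NAtOf (d := 3) hLc.pos (ctrOff_mem_box hLc.pos) cE cVH cΛ W Cw δw hδw hW j).W μ (bref α μ y) ν (bref α ν y') =
        (reflSign α μ * reflSign α ν) • refK (Φ Lc α)
          ((JsBal0NAtOf (d := 3) hLc.pos (ctrOff_mem_box hLc.pos) cE cVH cΛ W Cw δw hδw hW j).W μ y ν y' +
            conjW (bhKStepAt 3 (toSite (ctrOff 4 Lc)) Lc j)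
              (vertexOfK (coDressKBmAt (toSite (ctrOff 4 Lc)) Lc (KInvStep (d := 3) Lc j)) Lc
                (JsBal0NAtOf (d := 3) hLc.pos (ctrOff_mem_box hLc.pos) cE cVH cΛ W Cw δw hδw hW j).S μ y)
              (vertexOfK (coDressKBmAt (toSite (ctrOff 4 Lc)) Lc (KInvStep (d := 3) Lc j)) Lc
                (JsBal0NAtOf (d := 3) hLc.pos (ctrOff_mem_box hLc.pos) cE cVH cΛ W Cw δw hδw hW j).S ν y')
              (vertexOfK (coDressKBmAt (toSite (ctrOff 4 Lc)) Lc (KInvStep (d := 3) Lc j)) Lc (C j α) μ y)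
              (vertexOfK (coDressKBmAt (toSite (ctrOff 4 Lc)) Lc (KInvStep (d := 3) Lc j)) Lc (C j α) ν y') (X₂ j α μ y ν y'))) :
    ∀ j : ℕ, AxisReflectionCovariant
      (flipK (TbalOf Lc (JsBalBmNAtOf (d := 3) hLc.pos (ctrOff_mem_box hLc.pos) cE cVH cΛ W Cw δw hδw hW) j)) :=
  axisReflectionCovariant_flipK_TbalOf_JsBalBmNAtOf_ctrC_reduced hLc cE cVH cΛ W Cw δw hδw hW hWt
    (bhKStepAt 3 (toSite (ctrOff 4 Lc)) Lc) rfl (fun j => spr_bhKStepAt (ctrOff_mem_box (one_le_of_neZero Lc)) (j + 1)) h3S h4S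
    (stepScale 3 Lc) (fun j => stepScale_ne_zero (j + 1)) (fun j x z β μ => bhKStepAt_succ_fm j x z β μ)
    (fun j x z μ β => bhKStepAt_succ_mf j x z μ β) (fun j x z μ μ' => bhKStepAt_succ_mm j x z μ μ') γ hγ0 hγS C hCdef c hc0 hcS hWff
    hE3ff X₂ hX₂ hEX₂ hWrC

end

end Summit.QuantumFields.BalabanUV.Beta.SpineRooted
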